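import Summits.AtomisticToContinuum.Crystallization.Theorems.SquareWellLayerCakeStackingFaultSparsityOffBoxDefs
import Summits.AtomisticToContinuum.Crystallization.Theorems.PalmUnimodularRigidityLayeredLawsSelectHcpRelaxedReferenceTail
import Literature.MathematicalPhysics.StatisticalMechanics.LayerSumDecay
import Literature.MathematicalPhysics.StatisticalMechanics.BarlowStackingEnergy

/-!
# `StackingFaultSparsity` (stmt-AtomisticToContinuum-14296), line `Sketch`: the layer sums of the
certificate ARE the Lennard-Jones layer interactions (stub `stub_offBoxIdentities`)

For `a, h > 0` and `c = h/a` the physical layer interactions of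
`Literature/…/BarlowStackingEnergy.lean` are identified with the certified layer sums
`layerSum e c k = ∑' (i,j), hcpSumTerm e c (k, i, j)` of `…OffBoxDefs.lean`:

* `inLayerInteraction V_LJ a = (a¹²)⁻¹/12 · layerSum 6 c 0 - (a⁶)⁻¹/6 · layerSum 3 c 0`,
* `layerInteraction V_LJ a h 1 k
    = (a¹²)⁻¹/12 · layerSum 6 (k c) 1 - (a⁶)⁻¹/6 · layerSum 3 (k c) 1`,
* `layerInteraction V_LJ a h 0 k
    = (a¹²)⁻¹/12 · layerSum 6 (k c/2) 2 - (a⁶)⁻¹/6 · layerSum 3 (k c/2) 2`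

(`k ≠ 0`).  Termwise this is `‖layerVec a h δ k i j‖² = a² q_δ(i,j) + k²h²` (`normSq_layerVec`)
with `q₁ = hcpSumQ (1,i,j)` (shifted registry) and `q₀ = hcpSumQ (2,i,j)` (aligned;
`2² (kc/2)² = k²c²`), and `V_LJ(r) = (a¹²)⁻¹/12 · S⁻⁶ - (a⁶)⁻¹/6 · S⁻³` whenever `r² = a² S`; the
`tsum`s split because every layer family `(i,j) ↦ hcpSumTerm e c (k,i,j)` (`e ≥ 3`, `c > 0`) is
summable (`hcpSumTerm_summable_gen….prod_factor`).  All `[folklore]` bookkeeping.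
-/

noncomputable section

namespace Summit.AtomisticToContinuum.Crystallization.Theorems.SquareWellLayerCake.StackingFaultSparsity

open Literature.MathematicalPhysics.StatisticalMechanics
open Summit.AtomisticToContinuum.Crystallization.Theorems.ExcessDecayLiouvilleCoarseGrains
open Summit.AtomisticToContinuum.Crystallization.Theorems.PalmUnimodularRigidity.LayeredLawsSelectHcp

/-! ## Termwise identities -/

/-- `V_LJ(r) = (a¹²)⁻¹/12 · S⁻⁶ - (a⁶)⁻¹/6 · S⁻³` whenever `r² = a² S`. [folklore] -/
theorem offBoxIdentities_lennardJones_eq {r a S : ℝ} (hr : r ^ 2 = a ^ 2 * S) :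
    lennardJones r = 1 / 12 * (a ^ 12)⁻¹ * S⁻¹ ^ 6 - 1 / 6 * (a ^ 6)⁻¹ * S⁻¹ ^ 3 := by
  unfold lennardJones
  rw [show r⁻¹ ^ 12 = (r ^ 2)⁻¹ ^ 6 by ring, show r⁻¹ ^ 6 = (r ^ 2)⁻¹ ^ 3 by ring, hr]
  ring

/-- Off the origin the general term of the certified sums has no `if`. [folklore] -/
theorem offBoxIdentities_hcpSumTerm_of_ne_zero (e : ℕ) (c : ℝ) {v : ℤ × ℤ × ℤ} (hv : v ≠ 0) :
    hcpSumTerm e c v = (hcpSumQ v + (v.1 : ℝ) ^ 2 * c ^ 2)⁻¹ ^ e :=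
  if_neg hv

/-- **Shifted registry, termwise**: `V_LJ ‖layerVec a h 1 k i j‖` is the `(1, i, j)` term of the
certified sums at ratio `k h/a`. [folklore] -/
theorem offBoxIdentities_term_one {a : ℝ} (ha : a ≠ 0) (h : ℝ) (k : ℕ) (i j : ℤ) :
    lennardJones ‖layerVec a h 1 k i j‖ =
      1 / 12 * (a ^ 12)⁻¹ * hcpSumTerm 6 ((k : ℝ) * (h / a)) (1, i, j) -
        1 / 6 * (a ^ 6)⁻¹ * hcpSumTerm 3 ((k : ℝ) * (h / a)) (1, i, j) := by
  have hv : (((1 : ℤ), i, j) : ℤ × ℤ × ℤ) ≠ 0 := by simp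
  rw [offBoxIdentities_hcpSumTerm_of_ne_zero 6 _ hv, offBoxIdentities_hcpSumTerm_of_ne_zero 3 _ hv]
  apply offBoxIdentities_lennardJones_eq
  rw [normSq_layerVec, hcpSumQ_odd Int.not_even_one]
  push_cast
  field_simp
  ring

/-- **Aligned registry, termwise**: `V_LJ ‖layerVec a h 0 k i j‖` is the `(2, i, j)` term of the
certified sums at ratio `k h/(2a)`. [folklore] -/
theorem offBoxIdentities_term_zero {a : ℝ} (ha : a ≠ 0) (h : ℝ) (k : ℕ) (i j : ℤ) :
    lennardJones ‖layerVec a h 0 k i j‖ =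
      1 / 12 * (a ^ 12)⁻¹ * hcpSumTerm 6 ((k : ℝ) * (h / a) / 2) (2, i, j) -
        1 / 6 * (a ^ 6)⁻¹ * hcpSumTerm 3 ((k : ℝ) * (h / a) / 2) (2, i, j) := by
  have hv : (((2 : ℤ), i, j) : ℤ × ℤ × ℤ) ≠ 0 := by simp
  rw [offBoxIdentities_hcpSumTerm_of_ne_zero 6 _ hv, offBoxIdentities_hcpSumTerm_of_ne_zero 3 _ hv]
  apply offBoxIdentities_lennardJones_eq
  rw [normSq_layerVec, hcpSumQ_even even_two]
  push_cast
  field_simp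
  ring

/-- **In-layer, termwise**: the punctured term `[ij ≠ 0] V_LJ ‖i u + j v‖` is the `(0, i, j)`
term of the certified sums (any ratio `c`). [folklore] -/
theorem offBoxIdentities_term_inLayer (a h c : ℝ) (ij : ℤ × ℤ) :
    (if ij = 0 then 0
      else lennardJones ‖(ij.1 : ℝ) • triangularVec₁ a + (ij.2 : ℝ) • triangularVec₂ a‖) =
      1 / 12 * (a ^ 12)⁻¹ * hcpSumTerm 6 c (0, ij.1, ij.2) -
        1 / 6 * (a ^ 6)⁻¹ * hcpSumTerm 3 c (0, ij.1, ij.2) := by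
  by_cases hij : ij = 0
  · subst hij
    simp [hcpSumTerm]
  · have hv : (((0 : ℤ), ij.1, ij.2) : ℤ × ℤ × ℤ) ≠ 0 := by
      intro h0
      apply hij
      rw [Prod.mk_eq_zero, Prod.mk_eq_zero] at h0
      exact Prod.ext h0.2.1 h0.2.2
    rw [if_neg hij, offBoxIdentities_hcpSumTerm_of_ne_zero 6 _ hv,
      offBoxIdentities_hcpSumTerm_of_ne_zero 3 _ hv, ← layerVec_zero_zero a h]
    apply offBoxIdentities_lennardJones_eq
    rw [normSq_layerVec, hcpSumQ_even (show Even (0 : ℤ) from ⟨0, rfl⟩)]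
    push_cast
    ring

/-! ## The identities -/

/-- **Stub `stub_offBoxIdentities`**: for `a, h > 0` and `c = h/a`, the in-layer, shifted and
aligned Lennard-Jones layer interactions are
`(a¹²)⁻¹/12 · layerSum 6 · · - (a⁶)⁻¹/6 · layerSum 3 · ·` at the layers `0` (ratio `c`),
`1` (ratio `k c`) and `2` (ratio `k c/2`) of the certified sums. [folklore] -/
theorem stub_offBoxIdentities :
    ∀ (a h : ℝ), 0 < a → 0 < h →
      inLayerInteraction lennardJones a =
          1 / 12 * (a ^ 12)⁻¹ * layerSum 6 (h / a) 0 - 1 / 6 * (a ^ 6)⁻¹ * layerSum 3 (h / a) 0 ∧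
      (∀ k : ℕ, k ≠ 0 →
        layerInteraction lennardJones a h 1 (k : ℤ) =
          1 / 12 * (a ^ 12)⁻¹ * layerSum 6 ((k : ℝ) * (h / a)) 1 -
            1 / 6 * (a ^ 6)⁻¹ * layerSum 3 ((k : ℝ) * (h / a)) 1) ∧
      (∀ k : ℕ, k ≠ 0 →
        layerInteraction lennardJones a h 0 (k : ℤ) =
          1 / 12 * (a ^ 12)⁻¹ * layerSum 6 ((k : ℝ) * (h / a) / 2) 2 -
            1 / 6 * (a ^ 6)⁻¹ * layerSum 3 ((k : ℝ) * (h / a) / 2) 2) := by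
  intro a h ha hh
  have ha' : a ≠ 0 := ha.ne'
  have hc : 0 < h / a := div_pos hh ha
  have h36 : (3 : ℕ) ≤ 6 := by norm_num
  refine ⟨?_, fun k hk => ?_, fun k hk => ?_⟩
  · have h6 : Summable fun ij : ℤ × ℤ => hcpSumTerm 6 (h / a) (0, ij.1, ij.2) :=
      (hcpSumTerm_summable_gen h36 hc).prod_factor 0
    have h3 : Summable fun ij : ℤ × ℤ => hcpSumTerm 3 (h / a) (0, ij.1, ij.2) :=
      (hcpSumTerm_summable_gen le_rfl hc).prod_factor 0
    unfold inLayerInteraction layerSum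
    rw [tsum_congr (offBoxIdentities_term_inLayer a h (h / a)),
      (h6.mul_left _).tsum_sub (h3.mul_left _), tsum_mul_left, tsum_mul_left]
  · have hk' : 0 < (k : ℝ) * (h / a) := mul_pos (Nat.cast_pos.2 (Nat.pos_of_ne_zero hk)) hc
    have h6 : Summable fun ij : ℤ × ℤ => hcpSumTerm 6 ((k : ℝ) * (h / a)) (1, ij.1, ij.2) :=
      (hcpSumTerm_summable_gen h36 hk').prod_factor 1
    have h3 : Summable fun ij : ℤ × ℤ => hcpSumTerm 3 ((k : ℝ) * (h / a)) (1, ij.1, ij.2) :=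
      (hcpSumTerm_summable_gen le_rfl hk').prod_factor 1
    unfold layerInteraction layerSum
    rw [tsum_congr fun ij : ℤ × ℤ => offBoxIdentities_term_one ha' h k ij.1 ij.2,
      (h6.mul_left _).tsum_sub (h3.mul_left _), tsum_mul_left, tsum_mul_left]
  · have hk' : 0 < (k : ℝ) * (h / a) / 2 :=
      half_pos (mul_pos (Nat.cast_pos.2 (Nat.pos_of_ne_zero hk)) hc)
    have h6 : Summable fun ij : ℤ × ℤ => hcpSumTerm 6 ((k : ℝ) * (h / a) / 2) (2, ij.1, ij.2) :=
      (hcpSumTerm_summable_gen h36 hk').prod_factor 2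
    have h3 : Summable fun ij : ℤ × ℤ => hcpSumTerm 3 ((k : ℝ) * (h / a) / 2) (2, ij.1, ij.2) :=
      (hcpSumTerm_summable_gen le_rfl hk').prod_factor 2
    unfold layerInteraction layerSum
    rw [tsum_congr fun ij : ℤ × ℤ => offBoxIdentities_term_zero ha' h k ij.1 ij.2,
      (h6.mul_left _).tsum_sub (h3.mul_left _), tsum_mul_left, tsum_mul_left]

end Summit.AtomisticToContinuum.Crystallization.Theorems.SquareWellLayerCake.StackingFaultSparsity

end
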